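import Summits.BirchSwinnertonDyer.Rank1Residual.X11a.ChainBounded
import Summits.BirchSwinnertonDyer.Rank1Residual.Iwasawa.UnitCoefficientCertificateMultiplicative
import HarnessLib

/-!
# Class X11b = N8/O2 (lane CLASS-CLOSURE, seat `cc-typer-3`, target T-WK (a)): the RANK-FREE
# endpoint of x11a's weight-`k` chain — `μ^an(E,p) = 0` + the published Hida-family transfer give
# Mazur's main conjecture at a multiplicative `p ≥ 5` with `ρ̄_{E,p}` onto, NO analytic-rank
# hypothesis (cell `b2b-bsdres`)

HONEST FRAMING (verbatim, cell `b2b-bsdres`, run/shared/lean/b2b/bsd-rank1-residual/): the goal of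
the cell is to DELETE the COMBINATION-SHAPED residual classes for ALL analytic-rank `≤ 1` curves
over `ℚ` — "full BSD formula for every rank `≤ 1` curve in class `C`" assembled STRICTLY from
published theorems — so that the rank-`≤ 1` remainder becomes exactly the CONSTRUCTION-SHAPED
classes, which are TYPED (missing-input Props), NOT attempted; this is not "finishing BSD".
Lane CLASS-CLOSURE (coordinator ruling 2026-08-21T04:07Z): prove what is provable now; shrink each
hard class to its core with data; no claim beyond stated classes. THEOREMS ONLY (no definition, no
named fact, no `sorry`); nothing booked; no label / RESIDUAL-MAP mark changes; X11b stays
CONSTRUCTION-SHAPED; every theorem is CONDITIONAL on the named published facts and per-pair inputs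
it lists; a `μ^an = 0` unit coefficient is a finite per-pair certificate (instrument B-5 /
IWASAWA-CENSUS; EVIDENCE / instrumentation tier — its worth is referee A's / the lane's ruling).

## Why this file (cc-lead GEN 7 TARGET T-WK, `class-closure/OWNERS.md` §5 ⟦gen7 2026-08-21T07:24Z⟧)

x11a's chain of record `X11a.Chain.invariantsAt_normLam_of_facts_bdd` (`X11a/ChainBounded.lean`,
harvest-2 p241299) carries NO analytic-rank hypothesis: from the named facts (Hida's congruent
ordinary member of weight `k = p + 1`, Mazur–Tate–Teitelbaum weight-`k` interpolation, Emerton–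
Pollack–Weston Thm. 3.1.1 / Thm. 1 / Thm. 5.1.3 (bounded), X. Wan 2015 Thm. 4 rational (bounded),
Kato–Wuthrich A32, modular parametrisation), the existence inputs (E1)–(E3) and the per-pair
certificate `MuAnZeroAt W p`, it proves at a multiplicative `p ≥ 5` with `ρ̄_{E,p}` onto that every
Kato pair `(gK, fE)` (`ι(T^e gK) = ϖ·L_p`, `char_Λ X(E/ℚ_∞) = (fE)`) has unit contents and
`normLam gK = normLam fE`. The rank enters x11a's leaf only in the SOCKET
`X11a.mazurMainConjectureAt_of_invariantsMatchAt` (`X11a/InvariantsEndpoint.lean`), where `r_an = 0`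
serves to get `gK ≠ 0`. With the certificate that is free (`HasUnitContent gK ⇒ gK ≠ 0`); indeed unit
contents + `normLam gK = normLam fE` + Kato's `fE ∣ gK` give `(gK) = (fE)` by pure `Λ`-algebra
(Greenberg–Vatsal p. 4, tree `X1.MuLambda.span_eq_span_iff_mu_lam`), and iw-1's rank-free socket
`Iwasawa.mazurMainConjectureAt_of_invariantsAt_span_eq` (`Iwasawa/UnitCoefficientCertificateMultiplicative.lean`)
turns "`(gK) = (fE)` at every Kato pair" into `X2.MazurMainConjectureAt W p` (torsion = Kato;
generator = `fE`; unit from the domain `Λ`). Hence Mazur's main conjecture at the pair — integral,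
Néron-normalised, with the trivial zero: VERBATIM the typed input consumed in analytic rank ONE by
this seat's `X11b.ClassClosure.bsdp_of_mazurMainConjectureAt_of_regulatorNonvanishing` (p252284) and
by census-ctyper-2's sign-aware `X11b.RegMult.bsdp_of_mazurMainConjectureAt_of_cert` (p254516) —
follows RANK-FREE from x11a's named facts + `μ^an(E,p) = 0`. The X11b consumers (T-WK (b), (c)) are
the companion file `X11b/ClassClosureWeightKChainLever.lean`.

VERIFY points of the target: (i) rank-freeness — a reading in the ruling, CHECKED by the kernel here
(`mazurMainConjectureAt_of_facts_bdd` has no `analyticRank` binder); (ii) normalisation — the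
conclusion IS `X2.MazurMainConjectureAt W p`, the statement the rank-one lever consumes, exactly as
x11a's rank-zero glue `X2.bsdp_of_mazurMainConjectureAt_of_analyticRank_eq_zero` does (no
re-normalisation anywhere); (iii) the informational flags ride along UNCHANGED on the facts used:
`Wan15-Thm103-Fujiwara`, `Wan15-BCS25-Rem113ii`, `EPW-canonical-period`, `MTT86-primary-image-only`,
`Wu14-surj-attribution` (referee A's standing N7 reading applies verbatim; tier / label are referee
A's and the x11b3 lead's call, not this file's).

## Contents (class-free: any `E/ℚ`, multiplicative `p ≥ 5`, `ρ̄_{E,p}` onto; all CONDITIONAL)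
* `invariantsAt_span_eq_of_invariantsAt_normLam` — unit contents + equal `normLam` + Kato ⟹
  `(gK) = (fE)` at every Kato pair;
* `mazurMainConjectureAt_of_invariantsAt_normLam` — THE RANK-FREE ENDPOINT;
* `mazurMainConjectureAt_of_invariantsMatchAt_of_muAnZeroAt` — x11a's endpoint with `r_an = 0`
  replaced by the certificate; `mazurMainConjectureAt_iff_invariantsAt_normLam_of_muAnZeroAt` —
  exactness (the EPW-shaped endpoint loses nothing, rank-free);
* `mazurMainConjectureAt_of_facts_bdd` — T-WK (a): THE CHAIN with (E1)–(E3) displayed;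
  `mazurMainConjectureAt_of_namedFacts_bdd` — (E1)–(E3) discharged by the tree theorems of
  harvest-2 (p205893 / p206456 / p206115), named facts only;
  `mazurMainConjectureAt_of_namedFacts_bdd_of_unitCoeffAt` — fed by iw-1's `UnitCoeffAt W p n` row.

References: [EmertonPollackWeston2006] Thm. 1, 3.1.1, 5.1.2, 5.1.3, Def. 4.4.6; [Wan2015] Thm. 4
(= Thm. 103); [GreenbergVatsal2000] (1)–(2), p. 4; [Wuthrich2014] Thm. 3, Cor. 19;
[Skinner2016PacificMC] Thm. A, §3.2–3.3 (shape); [MazurTateTeitelbaum1986] §I.11, §I.14;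
[DeligneSerre1974] Thm. 6.1; [Hida2000] Thm. 3.26; HOME/class-closure/O2/TYPER-3.md §9 (GEN 3).
-/

set_option autoImplicit false

noncomputable section

open scoped Classical MatrixGroups ModularForm

open CongruenceSubgroup WeierstrassCurve Literature.NumberTheory.EllipticCurves
  Literature.NumberTheory.EllipticCurves.ModularForms
  Literature.NumberTheory.EllipticCurves.Rank1Residual
  Literature.NumberTheory.EllipticCurves.Rank1Residual.Typed
  Literature.NumberTheory.EllipticCurves.Wuthrich2014
  Literature.NumberTheory.EllipticCurves.SteinWuthrich2013
  Literature.NumberTheory.EllipticCurves.GreenbergVatsal2000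
  Literature.NumberTheory.EllipticCurves.EmertonPollackWeston2006
  Summit.BirchSwinnertonDyer.Rank1Residual.X1.MuLambda
  Summit.BirchSwinnertonDyer.Rank1Residual.X11a.LambdaNorm

namespace Summit.BirchSwinnertonDyer.Rank1Residual.X11b.ClassClosure

open X11a X11a.Chain

variable (W : WeierstrassCurve ℚ) [W.IsElliptic] [W.IsGloballyMinimal] (p : ℕ) [Fact p.Prime]

/-! ### The rank-free endpoint -/

/-- **Unit contents + equal `normLam` + Kato ⟹ `(gK) = (fE)` at every Kato pair** (pure
`Λ`-algebra; RANK-FREE). At a multiplicative `p ≥ 5` with `ρ̄_{E,p}` onto, Kato–Wuthrich A32 gives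
`fE ∣ gK` (`X11a.invariantsAt_dvd_of_kato`); unit contents give `gK, fE ≠ 0`, `μ(gK) = μ(fE) = 0`
and `λ = normLam` on both; then Greenberg–Vatsal's "`λ_alg = λ_an` and `μ_alg = μ_an` imply the Main
[statement]" (`X1.MuLambda.span_eq_span_iff_mu_lam`). [cite: GreenbergVatsal2000, p. 4 (after Thm. (1.2))]
[cite: Wuthrich2014, Thm. 3 (p. 382) and Cor. 19 proof (p. 399)] [cite: EmertonPollackWeston2006, Def. 4.4.6] -/
theorem invariantsAt_span_eq_of_invariantsAt_normLam
    (hKato : kato_charIdeal_dvd_multiplicative_of_surjective)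
    (hp : 5 ≤ p) (hmult : W.HasMultiplicativeReductionAtPrime p)
    (hsurj : W.HasSurjectiveModNGaloisRep p)
    (h : InvariantsAt W p fun g fE => HasUnitContent g ∧ HasUnitContent fE ∧ normLam g = normLam fE) :
    InvariantsAt W p fun g fE => Ideal.span ({g} : Set (IwasawaAlgebra p)) = Ideal.span {fE} :=
  (h.and (invariantsAt_dvd_of_kato W p hKato hp hmult hsurj)).mono fun g fE h' => by
    obtain ⟨⟨hg, hfE, hn⟩, ⟨c, hc⟩⟩ := h'
    exact (span_eq_span_iff_mu_lam (ne_zero_of_hasUnitContent hfE) (ne_zero_of_hasUnitContent hg)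
        hc).mpr
      ⟨by rw [mu_eq_zero_of_hasUnitContent hg, mu_eq_zero_of_hasUnitContent hfE],
        by rw [lam_eq_normLam hg, lam_eq_normLam hfE, hn]⟩

/-- **RANK-FREE ENDPOINT: EPW's invariants at `f_E` in `normLam` currency ⟹ Mazur's main conjecture
at `(E,p)`** (`X2.MazurMainConjectureAt W p`: torsion, a generator, a unit, Néron normalisation, the
trivial zero at a split `p`) — at a multiplicative `p ≥ 5` with `ρ̄_{E,p}` onto, NO analytic-rank
hypothesis (x11a's `mazurMainConjectureAt_of_invariantsMatchAt` needs `r_an = 0` only for `gK ≠ 0`).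
Socket: iw-1's `Iwasawa.mazurMainConjectureAt_of_invariantsAt_span_eq` (every `ρ̄_{E,p^n}` onto from
`ρ̄_{E,p}` onto by Serre, `surjective_pow_of_five_le`). CONDITIONAL on Kato–Wuthrich A32; nothing
booked. [cite: EmertonPollackWeston2006, Thm. 5.1.2 and Thm. 5.1.3] [cite: GreenbergVatsal2000, p. 4 (after Thm. (1.2))]
[cite: Wuthrich2014, Thm. 3 (p. 382) and Cor. 19 proof (p. 399)] -/
theorem mazurMainConjectureAt_of_invariantsAt_normLam
    (hKato : kato_charIdeal_dvd_multiplicative_of_surjective)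
    (hp : 5 ≤ p) (hmult : W.HasMultiplicativeReductionAtPrime p)
    (hsurj : W.HasSurjectiveModNGaloisRep p)
    (h : InvariantsAt W p fun g fE => HasUnitContent g ∧ HasUnitContent fE ∧ normLam g = normLam fE) :
    X2.MazurMainConjectureAt W p :=
  Iwasawa.mazurMainConjectureAt_of_invariantsAt_span_eq W p hKato (by omega) hmult
    (kato_charIdeal_dvd_multiplicative_of_surjective.surjective_pow_of_five_le W p hp hsurj)
    (invariantsAt_span_eq_of_invariantsAt_normLam W p hKato hp hmult hsurj h)

/-- **x11a's endpoint with `r_an = 0` replaced by the certificate**: at a multiplicative `p ≥ 5` with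
`ρ̄_{E,p}` onto, `InvariantsMatchAt W p` (EPW's "`μ^alg = μ^an`, `λ^alg = λ^an`" at `f_E`) and
`MuAnZeroAt W p` give Mazur's main conjecture at the pair — RANK-FREE (x11a gen 15's dictionary
`invariantsMatchAt_iff_invariantsAt_normLam_of_muAnZeroAt` + the endpoint above).
[cite: EmertonPollackWeston2006, Thm. 5.1.3 and Def. 4.4.6] [cite: GreenbergVatsal2000, p. 4 (after Thm. (1.2))] -/
theorem mazurMainConjectureAt_of_invariantsMatchAt_of_muAnZeroAt
    (hKato : kato_charIdeal_dvd_multiplicative_of_surjective)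
    (hp : 5 ≤ p) (hmult : W.HasMultiplicativeReductionAtPrime p)
    (hsurj : W.HasSurjectiveModNGaloisRep p) (hμ : MuAnZeroAt W p) (hinv : InvariantsMatchAt W p) :
    X2.MazurMainConjectureAt W p :=
  mazurMainConjectureAt_of_invariantsAt_normLam W p hKato hp hmult hsurj
    ((invariantsMatchAt_iff_invariantsAt_normLam_of_muAnZeroAt W p hKato hp hmult hsurj hμ).mp hinv)

/-- **EXACTNESS, rank-free**: at a multiplicative `p ≥ 5` with `ρ̄_{E,p}` onto and the certificate
`MuAnZeroAt W p`, Mazur's main conjecture at the pair ⟺ "unit contents and `normLam gK = normLam fE`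
at every Kato pair" (⟸ above; ⟹ x11a's pure-algebra converse `invariantsMatchAt_of_mazurMainConjectureAt`
read through the dictionary). So on X11b too the EPW-shaped endpoint loses nothing.
[cite: EmertonPollackWeston2006, Thm. 5.1.2, Thm. 5.1.3, Def. 4.4.6] [cite: GreenbergVatsal2000, p. 4 (after Thm. (1.2))] -/
theorem mazurMainConjectureAt_iff_invariantsAt_normLam_of_muAnZeroAt
    (hKato : kato_charIdeal_dvd_multiplicative_of_surjective)
    (hp : 5 ≤ p) (hmult : W.HasMultiplicativeReductionAtPrime p)
    (hsurj : W.HasSurjectiveModNGaloisRep p) (hμ : MuAnZeroAt W p) :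
    X2.MazurMainConjectureAt W p ↔
      InvariantsAt W p fun g fE => HasUnitContent g ∧ HasUnitContent fE ∧ normLam g = normLam fE :=
  ⟨fun hMC => (invariantsMatchAt_iff_invariantsAt_normLam_of_muAnZeroAt W p hKato hp hmult hsurj hμ).mp
      (invariantsMatchAt_of_mazurMainConjectureAt W p hMC),
    mazurMainConjectureAt_of_invariantsAt_normLam W p hKato hp hmult hsurj⟩

/-! ### The chain, rank-free -/

/-- **T-WK (a) — THE CHAIN, RANK-FREE: Mazur's main conjecture at `(E,p)` from x11a's named facts +
(E1)–(E3) + the certificate `μ^an(E,p) = 0`**, at a multiplicative `p ≥ 5` with `ρ̄_{E,p}` onto and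
NO analytic-rank hypothesis: x11a's `Chain.invariantsAt_normLam_of_facts_bdd` (Hida member `hHida`,
MTT weight-`k` `hMTT`, EPW Thm. 3.1.1 `h311` / Thm. 1 `hT1a` / Thm. 5.1.3 bounded `hT1b`, Wan Thm. 4
rational bounded `hT2`, Kato–Wuthrich A32 `hKato`, modular parametrisation `hpar`; (E1) `hData`,
(E2) `hDual`, (E3) `hGen` displayed) composed with `mazurMainConjectureAt_of_invariantsAt_normLam`.
Flags riding along (informational; referee A's standing reading): `Wan15-Thm103-Fujiwara`,
`Wan15-BCS25-Rem113ii`, `EPW-canonical-period`, `MTT86-primary-image-only`, `Wu14-surj-attribution`.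
CONDITIONAL; nothing booked. [cite: EmertonPollackWeston2006, Thm. 1, Thm. 3.1.1, Thm. 5.1.3]
[cite: Wan2015, Thm. 4] [cite: Wuthrich2014, Thm. 3 (p. 382) and Cor. 19 proof (p. 399)] -/
theorem mazurMainConjectureAt_of_facts_bdd [NeZero (W.conductorNorm ℤ / p)]
    (hHida : hida_exists_congruent_ordinary_newform_of_multiplicative)
    (hMTT : exists_isCycPAdicLFunctionWeightK)
    (h311 : thm311_cotorsion_weightK_member) (hT1a : thm1_muAlg_of_weightK_member)
    (hT2 : Wan2015.thm4_rational_weightK_member_of_bdd)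
    (hT1b : thm513_transfer_from_weightK_member_of_bdd)
    (hKato : kato_charIdeal_dvd_multiplicative_of_surjective)
    (hpar : nonempty_modularParametrizationData)
    (hData : ∀ {k : ℤ} (g : CuspForm (Gamma0 (W.conductorNorm ℤ / p)) k)
      (ι : coeffField g →+* PadicAlgCl p), IsOrdinaryMemberOf W p g ι →
      Nonempty (OrdinaryPadicData g p ι))
    (hDual : ∀ {k : ℤ} (g : CuspForm (Gamma0 (W.conductorNorm ℤ / p)) k)
      (ι : coeffField g →+* PadicAlgCl p), IsOrdinaryMemberOf W p g ι →
      ∀ (𝔇 : OrdinaryPadicData g p ι) (κ : ZpExtension ℚ p)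
      (γ : Field.absoluteGaloisGroup ℚ), κ.IsCyclotomic → κ.IsTopGenerator γ →
      Nonempty (GreenbergSelmer.DualData (padicCoeffField (memberGenerators g ι 𝔇.υ)) κ γ 𝔇.ρ 𝔇.plus))
    (hGen : ∀ {k : ℤ} (g : CuspForm (Gamma0 (W.conductorNorm ℤ / p)) k)
      (ι : coeffField g →+* PadicAlgCl p), IsOrdinaryMemberOf W p g ι →
      ∀ (𝔇 : OrdinaryPadicData g p ι) (κ : ZpExtension ℚ p)
      (γ : Field.absoluteGaloisGroup ℚ), κ.IsCyclotomic → κ.IsTopGenerator γ →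
      ∀ (D : GreenbergSelmer.DualData (padicCoeffField (memberGenerators g ι 𝔇.υ)) κ γ 𝔇.ρ 𝔇.plus),
      Module.Finite (PowerSeries (padicCoeffIntegers (memberGenerators g ι 𝔇.υ))) D.X →
      Module.IsTorsion (PowerSeries (padicCoeffIntegers (memberGenerators g ι 𝔇.υ))) D.X →
      ∃ G, D.charIdeal = Ideal.span {G})
    (hp : 5 ≤ p) (hmult : W.HasMultiplicativeReductionAtPrime p)
    (hsurj : W.HasSurjectiveModNGaloisRep p) (hμ : MuAnZeroAt W p) :
    X2.MazurMainConjectureAt W p :=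
  mazurMainConjectureAt_of_invariantsAt_normLam W p hKato hp hmult hsurj
    (invariantsAt_normLam_of_facts_bdd W p hHida hMTT h311 hT1a hT2 hT1b hKato hpar hData hDual hGen
      hp hmult hsurj hμ)

/-- **THE CHAIN ON NAMED FACTS ONLY, RANK-FREE**: as `mazurMainConjectureAt_of_facts_bdd` with the
existence inputs (E1)–(E3) DISCHARGED by the tree theorems used in `X11a.forall_bsdp_of_namedFacts_bdd`
— (E1) `exists_ordinaryPadicData_weightK_member_of_thm61_of_thm326` granted the named facts
`DeligneSerre1974.thm61_exists_adicGaloisRep` (`h61`) and `Hida2000_thm326_ordinary` (`h326`),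
(E2) `GreenbergSelmer.exists_dualData_weightK_member_unconditional`, (E3)
`charIdeal_isPrincipal_weightK_member_unconditional`. So: at a multiplicative `p ≥ 5` with `ρ̄_{E,p}`
onto, `MuAnZeroAt W p ⟹ X2.MazurMainConjectureAt W p` from NAMED PUBLISHED facts (Hida member; MTT;
EPW Thm 3.1.1 / Thm 1 / Thm 5.1.3 bounded; Wan Thm 4 rational bounded; Deligne–Serre 6.1; Hida 3.26;
Kato–Wuthrich A32; modularity), any analytic rank. CONDITIONAL; nothing booked; flags as above.
[cite: EmertonPollackWeston2006, Thm. 1, Thm. 3.1.1, Thm. 5.1.3, §3.1] [cite: Wan2015, Thm. 4]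
[cite: Wuthrich2014, Thm. 3 (p. 382) and Cor. 19 proof (p. 399)] -/
theorem mazurMainConjectureAt_of_namedFacts_bdd
    (hHida : hida_exists_congruent_ordinary_newform_of_multiplicative)
    (hMTT : exists_isCycPAdicLFunctionWeightK)
    (h311 : thm311_cotorsion_weightK_member) (hT1a : thm1_muAlg_of_weightK_member)
    (hT2 : Wan2015.thm4_rational_weightK_member_of_bdd)
    (hT1b : thm513_transfer_from_weightK_member_of_bdd)
    (h61 : DeligneSerre1974.thm61_exists_adicGaloisRep) (h326 : Hida2000_thm326_ordinary)
    (hKato : kato_charIdeal_dvd_multiplicative_of_surjective)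
    (hpar : nonempty_modularParametrizationData)
    (hp : 5 ≤ p) (hmult : W.HasMultiplicativeReductionAtPrime p)
    (hsurj : W.HasSurjectiveModNGaloisRep p) (hμ : MuAnZeroAt W p) :
    X2.MazurMainConjectureAt W p := by
  haveI : NeZero (W.conductorNorm ℤ / p) := neZero_conductorNorm_div W p hmult
  haveI : NeZero p := ⟨(Fact.out : p.Prime).ne_zero⟩
  have hirr : W.HasIrreducibleModPGaloisRep p :=
    hasIrreducibleModPGaloisRep_of_hasSurjectiveModNGaloisRep W p hsurj
  exact mazurMainConjectureAt_of_facts_bdd W p hHida hMTT h311 hT1a hT2 hT1b hKato hpar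
    (fun g ι hmem =>
      exists_ordinaryPadicData_weightK_member_of_thm61_of_thm326 h61 h326 W p hp hmult hirr g ι hmem)
    (fun g ι hmem 𝔇 κ γ hκ hγ =>
      GreenbergSelmer.exists_dualData_weightK_member_unconditional W p hp hmult hirr g ι hmem 𝔇 κ γ
        hκ hγ)
    (fun g ι hmem 𝔇 κ γ hκ hγ D hfin htors =>
      (charIdeal_isPrincipal_weightK_member_unconditional W p hp hmult hirr g ι hmem 𝔇 κ γ hκ hγ D
        hfin htors).principal)
    hp hmult hsurj hμ

/-- **The chain fed by a B-5 / IWASAWA-CENSUS row**: iw-1's unit-coefficient certificate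
`Iwasawa.UnitCoeffAt W p n` (the coefficient of index `n`, resp. `n + 1` at a split `p`, of `ϖ·L_p` is
a `p`-adic unit) refines `MuAnZeroAt W p` (`Iwasawa.muAnZeroAt_of_unitCoeffAt`), so it feeds the chain
on named facts. RANK-FREE; CONDITIONAL; nothing booked; the row is instrumentation.
[cite: GreenbergVatsal2000, p. 2–3, (2)] [cite: EmertonPollackWeston2006, Thm. 1, Thm. 5.1.3] [cite: Wan2015, Thm. 4] -/
theorem mazurMainConjectureAt_of_namedFacts_bdd_of_unitCoeffAt
    (hHida : hida_exists_congruent_ordinary_newform_of_multiplicative)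
    (hMTT : exists_isCycPAdicLFunctionWeightK)
    (h311 : thm311_cotorsion_weightK_member) (hT1a : thm1_muAlg_of_weightK_member)
    (hT2 : Wan2015.thm4_rational_weightK_member_of_bdd)
    (hT1b : thm513_transfer_from_weightK_member_of_bdd)
    (h61 : DeligneSerre1974.thm61_exists_adicGaloisRep) (h326 : Hida2000_thm326_ordinary)
    (hKato : kato_charIdeal_dvd_multiplicative_of_surjective)
    (hpar : nonempty_modularParametrizationData)
    (hp : 5 ≤ p) (hmult : W.HasMultiplicativeReductionAtPrime p)
    (hsurj : W.HasSurjectiveModNGaloisRep p) {n : ℕ} (hcert : Iwasawa.UnitCoeffAt W p n) :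
    X2.MazurMainConjectureAt W p :=
  mazurMainConjectureAt_of_namedFacts_bdd W p hHida hMTT h311 hT1a hT2 hT1b h61 h326 hKato hpar hp hmult
    hsurj (Iwasawa.muAnZeroAt_of_unitCoeffAt hcert)

end Summit.BirchSwinnertonDyer.Rank1Residual.X11b.ClassClosure

end
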